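import Summits.BirchSwinnertonDyer.BirchSwinnertonDyer.Theorems.ClassRecordThreeEulerHalvesAtThreeCartanDegreeOfStubsVal
import HarnessLib

/-!
# Crux 23422 `EulerHalvesAtThreeResidualUpperBound`, line `cartan`: TIGHTNESS of the 3-adic hom-lattice dictionary (F2b♭) — over a Cartan torus lattice a
# pair of degrees is realised 3-adically iff it obeys the one-place law `ord₃ dX = ord₃ dC + 1` (given S-K1′)

Seat `bsd-stepL-cartan-f2b` (g0; explicit-unit research prover on the stub (F2b) of `Lines/cartan.lean` v8′; `--supports stmt-BirchSwinnertonDyer-23422 --as helper`).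
Theorems only; sorry-free; axioms trio. Companion of `…CartanDegreeValDefs` (p682137: (F2b♭) `CartanHomLatticeDictionaryAtThreeVal`) and `…CartanDegreeOfStubsVal`
(p682343: (F2) re-derived from (F2b♭); `isSquare_of_degreeData`; `CartanTorusDegreeData.exists_ofGenerators`).
* `val_law_of_degreeData_val` (→): under S-K1′ a torus–degree datum realising `(dX, dC)` 3-adically forces `ord₃ dX = ord₃ dC + 1` (the lattice law, p678128).
* `exists_degreeData_val_of_law` (←, the 3-power-rescaled constructor): under S-K1′, every Cartan torus lattice at a prime `q ≠ 3` with non-zero generators of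
  its two torus-fixed lines realises 3-adically every pair with `ord₃ dX = ord₃ dC + 1` — `m := ord₃(B(w_C,w_C)(q−1)²)` (so `ord₃(B(w_s,w_s)(q²−1)) = m + 1` by
  S-K1′), `k := ord₃ dC`, `idx_T = 1`, `c := (q−1)²(q²−1)3ᵏ/(2·3ᵐ)`, `degX0 := B(w_s,w_s)(q²−1)/3ᵐ·3ᵏ`, `degC := B(w_C,w_C)(q−1)²/3ᵐ·3ᵏ`.
* `exists_degreeData_val_iff` (↔).
CONSEQUENCE for the line (informational): given (F2a) S-K1′ and a supply of Cartan torus lattices (pure finite-group theory — the integral models of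
`PS(χ,χ⁻¹)` ∕ `σ_θ` with their torus-fixed lines), the open input (F2b♭) at `(V, q, Q, Q')` is EQUIVALENT to the one-place relation
`ord₃ Q'.deg = ord₃ Q.deg + 1`; i.e. the cut (F2) = (F2a) ∘ (F2b♭) ∘ (F2⁰) of bsd-idea-10 is lossless, and (F2b♭) carries no hidden strength beyond the
one-place 3-adic degree law (unlike the exact (F2b), cf. `isSquare_of_degreeData`). HONEST FRAMING: nothing is asserted about any curve; (F2b♭) and the
degree law stay open (beyond print, Kohen–Pacetti Rem. 3.8); no summit statement, no route item is proved; BSD is proved for no curve.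
References: [cite: KohenPacetti2016, Rem. 3.8 (p. 15), §2] [cite: CaiShuTian2014, §1.2 p. 5].
-/

set_option linter.dupNamespace false -- the layout namespace `Summit.BirchSwinnertonDyer.BirchSwinnertonDyer.…` repeats the summit name (D-0017; as the sibling Defs)
set_option autoImplicit false

noncomputable section

open scoped Classical MatrixGroups NumberField UpperHalfPlane

namespace Summit.BirchSwinnertonDyer.BirchSwinnertonDyer.Theorems.CartanDegree

open WeierstrassCurve IsDedekindDomain NumberField Field Literature.NumberTheory.EllipticCurves
  Literature.NumberTheory.EllipticCurves.ModularForms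
  Literature.NumberTheory.EllipticCurves.Rank1Residual Literature.NumberTheory.Automorphic
  Summit.BirchSwinnertonDyer.Rank1Residual Summit.BirchSwinnertonDyer.BirchSwinnertonDyer.Theorems

/-! ## §4 Tightness: over a given lattice a pair of degrees is realised 3-adically iff it obeys the one-place law (given S-K1′) -/

section Tightness

/-- PROVED (→ of the tightness): under S-K1′, if some torus–degree datum at a prime `q ≠ 3` realises `(dX, dC)` 3-adically then
`ord₃ dX = ord₃ dC + 1` (the lattice law). [folklore] -/
theorem val_law_of_degreeData_val (h2a : CubicTorusPeriodRatioAtThree) {q : ℕ} (hq : q.Prime) (hq3 : q ≠ 3)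
    (𝒟 : CartanTorusDegreeData q) {dX dC : ℕ}
    (hX : padicValNat 3 𝒟.degX0 = padicValNat 3 dX) (hC : padicValNat 3 𝒟.degC = padicValNat 3 dC) :
    padicValNat 3 dX = padicValNat 3 dC + 1 := by
  have hlaw := latticeDegreeLaw_of_periodRatio h2a q hq hq3 𝒟
  omega

/-- PROVED (← of the tightness, the 3-power-rescaled constructor): under S-K1′, EVERY Cartan torus lattice at a prime `q ≠ 3` with non-zero generators
of its two torus-fixed lines realises 3-adically EVERY pair `(dX, dC)` with `ord₃ dX = ord₃ dC + 1`: with `m := ord₃(B(w_C,w_C)(q−1)²)` (so that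
`ord₃(B(w_s,w_s)(q²−1)) = m + 1` by S-K1′) and `k := ord₃ dC`, take `idx_T = 1`, `c := (q−1)²(q²−1)·3ᵏ/(2·3ᵐ)`, `degX0 := B(w_s,w_s)(q²−1)/3ᵐ · 3ᵏ`,
`degC := B(w_C,w_C)(q−1)²/3ᵐ · 3ᵏ`. Hence, given S-K1′ and a supply of lattices (finite-group theory), the 3-adic dictionary (F2b♭) at `(V, q, Q, Q')`
is EQUIVALENT to the one-place relation `ord₃ Q'.deg = ord₃ Q.deg + 1`: the cut (F2) = (F2a) ∘ (F2b♭) ∘ (F2⁰) is lossless. [folklore] -/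
theorem exists_degreeData_val_of_law (h2a : CubicTorusPeriodRatioAtThree) {q : ℕ} (hq : q.Prime) (hq3 : q ≠ 3)
    (𝓛 : CartanTorusLattice q) (wS wC : Fin 𝓛.d → ℤ)
    (hS : 𝓛.IsSplitFixed wS) (hC : 𝓛.IsNonsplitFixed wC)
    (hSg : ∀ v, 𝓛.IsSplitFixed v → ∃ m : ℤ, v = m • wS) (hCg : ∀ v, 𝓛.IsNonsplitFixed v → ∃ m : ℤ, v = m • wC)
    (hwS : wS ≠ 0) (hwC : wC ≠ 0) {dX dC : ℕ} (hval : padicValNat 3 dX = padicValNat 3 dC + 1) :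
    ∃ 𝒟 : CartanTorusDegreeData q, 𝒟.toCartanTorusLattice = 𝓛 ∧
      padicValNat 3 𝒟.degX0 = padicValNat 3 dX ∧ padicValNat 3 𝒟.degC = padicValNat 3 dC := by
  haveI : Fact (Nat.Prime 3) := ⟨Nat.prime_three⟩
  have hq1 : 1 < q := hq.one_lt
  have hBS : 0 < 𝓛.B wS wS := 𝓛.B_pos _ hwS
  have hBC : 0 < 𝓛.B wC wC := 𝓛.B_pos _ hwC
  -- the two `B`-values as natural numbers
  set bs : ℕ := (𝓛.B wS wS).natAbs with hbs_def
  set bc : ℕ := (𝓛.B wC wC).natAbs with hbc_def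
  have hbsZ : (bs : ℤ) = 𝓛.B wS wS := Int.natAbs_of_nonneg hBS.le
  have hbcZ : (bc : ℤ) = 𝓛.B wC wC := Int.natAbs_of_nonneg hBC.le
  have hbs : bs ≠ 0 := Int.natAbs_ne_zero.mpr (ne_of_gt hBS)
  have hbc : bc ≠ 0 := Int.natAbs_ne_zero.mpr (ne_of_gt hBC)
  have hqm1 : q - 1 ≠ 0 := by omega
  have hqp1 : q + 1 ≠ 0 := by omega
  have hsq : q ^ 2 - 1 = (q + 1) * (q - 1) := by
    have := Nat.sq_sub_sq q 1
    simpa using this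
  have hq21 : q ^ 2 - 1 ≠ 0 := by rw [hsq]; exact mul_ne_zero hqp1 hqm1
  -- S-K1′ for this lattice, in `ℕ`
  have hper := h2a q hq hq3 𝓛 wS wC hS hSg hC hCg
  have hperN : padicValNat 3 bs + padicValNat 3 (q + 1) = padicValNat 3 bc + 1 + padicValNat 3 (q - 1) := hper
  -- the exponents
  set m : ℕ := padicValNat 3 (bc * (q - 1) ^ 2) with hm_def
  have hm : m = padicValNat 3 bc + 2 * padicValNat 3 (q - 1) := by
    rw [hm_def, padicValNat.mul hbc (pow_ne_zero 2 hqm1), padicValNat.pow]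
  have hmS : padicValNat 3 (bs * (q ^ 2 - 1)) = m + 1 := by
    rw [hsq, padicValNat.mul hbs (mul_ne_zero hqp1 hqm1), padicValNat.mul hqp1 hqm1]
    omega
  have hgC : 3 ^ m ∣ bc * (q - 1) ^ 2 := pow_padicValNat_dvd
  have hgS : 3 ^ m ∣ bs * (q ^ 2 - 1) :=
    (padicValNat_dvd_iff_le (mul_ne_zero hbs hq21)).mpr (by omega)
  set k : ℕ := padicValNat 3 dC with hk_def
  have h3m : (3 : ℕ) ^ m ≠ 0 := pow_ne_zero m (by norm_num)
  have h3k : (3 : ℕ) ^ k ≠ 0 := pow_ne_zero k (by norm_num)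
  -- the two degrees and their valuations
  set eX : ℕ := bs * (q ^ 2 - 1) / 3 ^ m * 3 ^ k with heX_def
  set eC : ℕ := bc * (q - 1) ^ 2 / 3 ^ m * 3 ^ k with heC_def
  have heXq : bs * (q ^ 2 - 1) / 3 ^ m ≠ 0 := by
    intro h0
    rcases (Nat.div_eq_zero_iff).mp h0 with h | h
    · exact h3m h
    · exact absurd (Nat.le_of_dvd (Nat.pos_of_ne_zero (mul_ne_zero hbs hq21)) hgS) (not_le.mpr h)
  have heCq : bc * (q - 1) ^ 2 / 3 ^ m ≠ 0 := by
    intro h0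
    rcases (Nat.div_eq_zero_iff).mp h0 with h | h
    · exact h3m h
    · exact absurd (Nat.le_of_dvd (Nat.pos_of_ne_zero (mul_ne_zero hbc (pow_ne_zero 2 hqm1))) hgC) (not_le.mpr h)
  have hvX : padicValNat 3 eX = k + 1 := by
    rw [heX_def, padicValNat.mul heXq h3k, padicValNat.div_pow hgS, padicValNat.prime_pow, hmS]
    omega
  have hvC : padicValNat 3 eC = k := by
    rw [heC_def, padicValNat.mul heCq h3k, padicValNat.div_pow hgC, padicValNat.prime_pow, ← hm_def]
    omega
  have heX_pos : 0 < eX := Nat.pos_of_ne_zero (by rw [heX_def]; exact mul_ne_zero heXq h3k)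
  have heC_pos : 0 < eC := Nat.pos_of_ne_zero (by rw [heC_def]; exact mul_ne_zero heCq h3k)
  -- casts to `ℚ`
  have hq1Q : (1 : ℚ) < (q : ℚ) := by exact_mod_cast hq1
  have cq2 : (((q ^ 2 - 1 : ℕ) : ℕ) : ℚ) = (q : ℚ) ^ 2 - 1 := by
    rw [Nat.cast_sub (Nat.one_le_pow 2 q (by omega))]; push_cast; ring
  have cq1 : (((q - 1 : ℕ) : ℕ) : ℚ) = (q : ℚ) - 1 := by
    rw [Nat.cast_sub (by omega : 1 ≤ q)]; push_cast; ring
  have h3mQ : ((3 ^ m : ℕ) : ℚ) ≠ 0 := by exact_mod_cast h3m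
  have ceX : (eX : ℚ) = (bs : ℚ) * ((q : ℚ) ^ 2 - 1) / ((3 ^ m : ℕ) : ℚ) * ((3 ^ k : ℕ) : ℚ) := by
    rw [heX_def, Nat.cast_mul, Nat.cast_div hgS h3mQ, Nat.cast_mul, cq2]
  have ceC : (eC : ℚ) = (bc : ℚ) * ((q : ℚ) - 1) ^ 2 / ((3 ^ m : ℕ) : ℚ) * ((3 ^ k : ℕ) : ℚ) := by
    rw [heC_def, Nat.cast_mul, Nat.cast_div hgC h3mQ, Nat.cast_mul, Nat.cast_pow, cq1]
  have cBS : ((𝓛.B wS wS : ℤ) : ℚ) = (bs : ℚ) := by rw [← hbsZ]; rfl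
  have cBC : ((𝓛.B wC wC : ℤ) : ℚ) = (bc : ℚ) := by rw [← hbcZ]; rfl
  refine ⟨{ toCartanTorusLattice := 𝓛
            wS := wS
            wC := wC
            wS_fixed := hS
            wC_fixed := hC
            wS_gen := hSg
            wC_gen := hCg
            c := ((q : ℚ) - 1) ^ 2 * ((q : ℚ) ^ 2 - 1) * ((3 ^ k : ℕ) : ℚ) / (2 * ((3 ^ m : ℕ) : ℚ))
            c_pos := by
              have h1 : (0 : ℚ) < ((q : ℚ) - 1) ^ 2 := by nlinarith
              have h2 : (0 : ℚ) < (q : ℚ) ^ 2 - 1 := by nlinarith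
              have h3 : (0 : ℚ) < ((3 ^ k : ℕ) : ℚ) := by positivity
              have h4 : (0 : ℚ) < ((3 ^ m : ℕ) : ℚ) := by positivity
              positivity
            uS := wS
            uC := wC
            idxS := 1
            idxC := 1
            uS_eq := (one_smul ℤ wS).symm
            uC_eq := (one_smul ℤ wC).symm
            descent_s := by decide
            descent_C := by decide
            degX0 := eX
            degC := eC
            degX0_pos := heX_pos
            degC_pos := heC_pos
            sheet_s := by
              rw [cBS, ceX]
              field_simp
            sheet_C := by
              rw [cBC, ceC]
              field_simp }, rfl, ?_, ?_⟩
  · show padicValNat 3 eX = padicValNat 3 dX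
    rw [hvX, hval]
  · show padicValNat 3 eC = padicValNat 3 dC
    rw [hvC]

/-- PROVED — **tightness of the 3-adic dictionary over a lattice**: under S-K1′, for a Cartan torus lattice at a prime `q ≠ 3` with non-zero generators of its
two torus-fixed lines, a pair `(dX, dC)` is realised 3-adically by a torus–degree datum on that lattice iff `ord₃ dX = ord₃ dC + 1`. [folklore] -/
theorem exists_degreeData_val_iff (h2a : CubicTorusPeriodRatioAtThree) {q : ℕ} (hq : q.Prime) (hq3 : q ≠ 3)
    (𝓛 : CartanTorusLattice q) (wS wC : Fin 𝓛.d → ℤ)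
    (hS : 𝓛.IsSplitFixed wS) (hC : 𝓛.IsNonsplitFixed wC)
    (hSg : ∀ v, 𝓛.IsSplitFixed v → ∃ m : ℤ, v = m • wS) (hCg : ∀ v, 𝓛.IsNonsplitFixed v → ∃ m : ℤ, v = m • wC)
    (hwS : wS ≠ 0) (hwC : wC ≠ 0) (dX dC : ℕ) :
    (∃ 𝒟 : CartanTorusDegreeData q, 𝒟.toCartanTorusLattice = 𝓛 ∧
        padicValNat 3 𝒟.degX0 = padicValNat 3 dX ∧ padicValNat 3 𝒟.degC = padicValNat 3 dC) ↔
      padicValNat 3 dX = padicValNat 3 dC + 1 :=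
  ⟨fun ⟨𝒟, _, hX, hC'⟩ => val_law_of_degreeData_val h2a hq hq3 𝒟 hX hC',
    fun hval => exists_degreeData_val_of_law h2a hq hq3 𝓛 wS wC hS hC hSg hCg hwS hwC hval⟩

end Tightness

end Summit.BirchSwinnertonDyer.BirchSwinnertonDyer.Theorems.CartanDegree

end
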